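import Literature.AlgebraicGeometry.AbelianSchemes.AbelianSchemeFibreAlongIntegralPoint
import Literature.AlgebraicGeometry.Motives.ValuationRingPointFiniteStage
import HarnessLib

/-!
# The fibre tuple of an abelian scheme along the FINITE (Dedekind) STAGE of an integral point
# ([SerreTate1968] §1; [EGAIV3] 8.8.2; [NeukirchANT1999] II (4.8); [MumfordFogartyKirwan1994] Ch. 7 §2 Def. 7.2)

Topic `AlgebraicGeometry/AbelianSchemes`; namespaces `Literature.AlgebraicGeometry.Motives` (§1–§2) and
`Literature.AlgebraicGeometry.AbelianSchemes.AbelianSchemeOver` (§3).  THEOREMS ONLY (no definition, no named fact, no instance, no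
notation, no `sorry`).  Cell `hodgecm-mathlib` (D-0151), programme F0∕P6 «MOD», organ **(ν4)** of the G1c «ROOF REDUCTION» remainder
(A-p17 (g26) FINDING 2026-09-01 «G1c BASE IS NOT DEDEKIND»; sequel of ★ (ν1) `Motives/ValuationRingPointFiniteStage` and of ★ (d5)
`AbelianSchemeFibreAlongIntegralPoint`).

THE POINT.  ★ (d5) reads the fibre tuple of an abelian scheme `𝒜 → 𝓨` (the universal family over a proper model `𝓨`) at a point
`x ∈ Y(Ω)` and at its reduction `red_𝓨 x` as the GENERIC and the SPECIAL fibre tuple of `𝒜_x̃ → Spec R` along the integral point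
`x̃ : Spec R → 𝓨`, `R = 𝒪_{Ω̄}` (★ `closureValuationSubring`) — a base over which the ★ Néron engines (`IsDedekindDomain`) do NOT run.
By ★ (ν1) `x̃ = Spec h ≫ z` for a point `z : Spec D → 𝓨` of a FINITE STAGE `D = integralClosure 𝒪[K_v] L`, `[L : K_v] < ∞` (a Dedekind
domain, ★ `isDedekindDomain_integralClosure`).  This file RE-BASES (d5) on the stage: the fibre tuple at `x` (resp. at `red_𝓨 x`) IS
the fibre tuple of `𝒜_z := 𝒜 ×_𝓨 Spec D` at the GEOMETRIC GENERIC point `Spec Ω → Spec R → Spec D` (resp. at the GEOMETRIC CLOSED point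
`Spec κ̄(v) → Spec κ(R) → Spec R → Spec D`) — ONE family of isomorphisms natural in `𝒜` (homomorphisms `ι(a)`, `λ`) and carrying
pulled-back sections (levels) to pulled-back sections (★ `exists_iso_fibre_baseChange_of_comp_eq` along the two ★ point equalities
`left_specFractionFieldι_comp_extendPoint_modelPointsEquiv_symm` ∕ `left_geomReductionMap_comp_fst` composed with `x̃ = Spec h ≫ z`).  So
the σ-pens of `stub_HFROB` work over the DEDEKIND `D` end to end: descend the roof to a finite stage (★ (ν2a)(ν2b)
`AbelianSchemeMorphismSpreadFiniteStage` ∕ `IsMonHomOfPullbackSchematicDominant`), refine the stage (§1), extend over `D′` (★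
`existsUnique_hom_map_genericFibre_eq′`), read the special fibre (★ `isIsogeny_fibreHom_of_isIsogeny_genericFibre` at the `κ̄`-point of
`Spec D′`; or ★ (ν3) `AbelianSchemeHomExtensionFromDedekindStage` over `R`).

* §1 `exists_ringHom_integralClosure_of_le` — STAGE REFINEMENT `L ≤ L′`: the inclusion `integralClosure 𝒪[F] L → integralClosure 𝒪[F] L′`
  (characterised on elements, injective), compatible with the inclusions into `R` of ★ (ν1).
* §2 `exists_finiteStage_comp_eq_pair` — a COMMON finite stage for TWO `R`-points (of two `𝓞ᵥ`-schemes locally of finite type): the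
  roof's `y`, `quotΩ y L` (★ (ν1) twice + §1 at `L₁ ⊔ L₂`, Mathlib `IntermediateField.finiteDimensional_sup`).
* §3 `exists_iso_fibre_generic_along_stagePoint`, `exists_iso_fibre_special_along_stagePoint` — the (d5) readings along ANY factorisation
  `x̃ = Spec h ≫ z` of the integral point through an `𝓞ᵥ`-algebra `D` (no hypothesis on `D`; instantiate with ★ (ν1)
  `exists_finiteStage_comp_eq_numberField`).

HONEST LABEL: HC_CM is proved only modulo the cell's 2 remaining named inputs (hLiu418 24832, h413 24833) until rung 0 closes; generic
capital on `--supports stmt-HodgeConjecture-24832`, pays no letter.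

## References
* [SerreTate1968] J.-P. Serre, J. Tate, *Good reduction of abelian varieties*, Ann. of Math. 88 (1968), §1 (the reduction map; Lemma 2).
* [EGAIV3] A. Grothendieck, J. Dieudonné, EGA IV₃ (1966), Thm. 8.8.2.
* [NeukirchANT1999] J. Neukirch, *Algebraic Number Theory* (1999), Ch. II (4.8), Ch. I (8.1).
* [MumfordFogartyKirwan1994] D. Mumford, J. Fogarty, F. Kirwan, *GIT*, 3rd ed., Ch. 7 §2 Def. 7.2 (p. 129).
* [GortzWedhorn2020] U. Görtz, T. Wedhorn, *Algebraic Geometry I*, 2nd ed., Section (4.7) (p. 135), Prop. 4.16.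
* [Hartshorne1977] R. Hartshorne, *Algebraic Geometry*, II.4.7, II.3 Thm. 3.3.
-/

set_option autoImplicit false

noncomputable section

-- `(specOver K Ω).left = Spec Ω`, `(Over.mk f).left` etc. are definitional only above `instances` transparency (as in ★ (d1)–(d5)).
set_option backward.isDefEq.respectTransparency false

universe u

open CategoryTheory CategoryTheory.Limits AlgebraicGeometry

/-! ## §1 Stage refinement -/

namespace Literature.AlgebraicGeometry.Motives

open ValuativeRel Literature.NumberTheory.GaloisRepresentations

section Refine

variable {F : Type u} [Field F] [ValuativeRel F] [TopologicalSpace F] [IsNonarchimedeanLocalField F]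

omit [TopologicalSpace F] [IsNonarchimedeanLocalField F] in
/-- **Stage refinement.**  For intermediate fields `F ⊆ L ⊆ L′ ⊆ F̄` the inclusion induces an injective ring map
`i : integralClosure 𝒪[F] L → integralClosure 𝒪[F] L′` with `i x = x` in `F̄` (integrality is preserved along the injective
`F`-algebra map `L → L′`). [cite: NeukirchANT1999, Ch. I (8.1)] -/
theorem exists_ringHom_integralClosure_of_le {L L' : IntermediateField F (AlgebraicClosure F)} (hLL' : L ≤ L') :
    ∃ i : integralClosure 𝒪[F] L →+* integralClosure 𝒪[F] L',
      (∀ x, (((i x : integralClosure 𝒪[F] L') : L') : AlgebraicClosure F) = ((x : L) : AlgebraicClosure F)) ∧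
      Function.Injective i := by
  have hint : ∀ x : integralClosure 𝒪[F] L, IsIntegral 𝒪[F] (IntermediateField.inclusion hLL' (x : L)) := by
    intro x
    exact (x.2.map ((IntermediateField.inclusion hLL').restrictScalars 𝒪[F]) : _)
  refine ⟨{ toFun := fun x => ⟨IntermediateField.inclusion hLL' (x : L), hint x⟩
            map_one' := Subtype.ext (by simp)
            map_mul' := fun a b => Subtype.ext (by simp)
            map_zero' := Subtype.ext (by simp)
            map_add' := fun a b => Subtype.ext (by simp) }, fun x => rfl, ?_⟩
  intro x y hxy
  have h1 : IntermediateField.inclusion hLL' (x : L) = IntermediateField.inclusion hLL' (y : L) := congrArg Subtype.val hxy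
  exact Subtype.ext (IntermediateField.inclusion_injective hLL' h1)

/-- **Stage refinement is compatible with the inclusions into `R`** (★ (ν1) `exists_ringHom_integralClosure_closureValuationSubring`):
if `h : integralClosure 𝒪[F] L → R` and `h′ : integralClosure 𝒪[F] L′ → R` are the inclusions (`h x = x`, `h′ x′ = x′` in `F̄`) and
`i` the refinement (`i x = x` in `F̄`), then `h′ ∘ i = h`. [cite: NeukirchANT1999, Ch. II (4.8)] -/
theorem comp_eq_of_coe_eq {L L' : IntermediateField F (AlgebraicClosure F)}
    (i : integralClosure 𝒪[F] L →+* integralClosure 𝒪[F] L')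
    (hi : ∀ x, (((i x : integralClosure 𝒪[F] L') : L') : AlgebraicClosure F) = ((x : L) : AlgebraicClosure F))
    (h : integralClosure 𝒪[F] L →+* closureValuationSubring F)
    (hh : ∀ x, ((h x : closureValuationSubring F) : AlgebraicClosure F) = ((x : L) : AlgebraicClosure F))
    (h' : integralClosure 𝒪[F] L' →+* closureValuationSubring F)
    (hh' : ∀ x, ((h' x : closureValuationSubring F) : AlgebraicClosure F) = ((x : L') : AlgebraicClosure F)) :
    h'.comp i = h := by
  ext x
  change ((h' (i x) : closureValuationSubring F) : AlgebraicClosure F) = ((h x : closureValuationSubring F) : AlgebraicClosure F)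
  rw [hh', hi, hh]

end Refine

/-! ## §2 A common finite stage for two integral points -/

section Pair

open IsDedekindDomain IsDedekindDomain.HeightOneSpectrum Literature.NumberTheory.DiophantineGeometry
open scoped NumberField

variable {K : Type} [Field K] [NumberField K] (v : HeightOneSpectrum (𝓞 K))

/-- **Two `R`-points factor through ONE finite stage.**  For `𝓞ᵥ`-schemes `𝒳₁, 𝒳₂` locally of finite type and `𝓞ᵥ`-morphisms
`l₁ : Spec R → 𝒳₁`, `l₂ : Spec R → 𝒳₂` (`R = closureValuationSubring (v.adicCompletion K)`) there are ONE finite extension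
`K_v ⊆ L ⊆ Ω`, the inclusion `h : R_L = integralClosure 𝒪[K_v] L → R` and `𝓞ᵥ`-morphisms `zᵢ : Spec R_L → 𝒳ᵢ` with `Spec h ≫ zᵢ = lᵢ`
(★ (ν1) `exists_finiteStage_comp_eq_numberField` for each point, then the refinement §1 to `L₁ ⊔ L₂`, finite by Mathlib
`IntermediateField.finiteDimensional_sup`). [cite: EGAIV3, Thm. 8.8.2] [cite: NeukirchANT1999, Ch. II (4.8)] -/
theorem exists_finiteStage_comp_eq_pair (𝒳₁ 𝒳₂ : SchemeOver (valuationSubringAtPrime K v))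
    [LocallyOfFiniteType 𝒳₁.hom] [LocallyOfFiniteType 𝒳₂.hom]
    (l₁ : specValuationSubring (closureValuationSubring (v.adicCompletion K)) (toClosureValuationSubring v) ⟶ 𝒳₁)
    (l₂ : specValuationSubring (closureValuationSubring (v.adicCompletion K)) (toClosureValuationSubring v) ⟶ 𝒳₂) :
    ∃ (L : IntermediateField (v.adicCompletion K) (AlgebraicClosure (v.adicCompletion K)))
      (_ : FiniteDimensional (v.adicCompletion K) L)
      (h : integralClosure 𝒪[v.adicCompletion K] L →+* closureValuationSubring (v.adicCompletion K))
      (z₁ : Over.mk (Spec.map (CommRingCat.ofHom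
          ((algebraMap 𝒪[v.adicCompletion K] (integralClosure 𝒪[v.adicCompletion K] L)).comp (toLocalInteger v)))) ⟶ 𝒳₁)
      (z₂ : Over.mk (Spec.map (CommRingCat.ofHom
          ((algebraMap 𝒪[v.adicCompletion K] (integralClosure 𝒪[v.adicCompletion K] L)).comp (toLocalInteger v)))) ⟶ 𝒳₂)
      (w : Spec.map (CommRingCat.ofHom h) ≫
          Spec.map (CommRingCat.ofHom
            ((algebraMap 𝒪[v.adicCompletion K] (integralClosure 𝒪[v.adicCompletion K] L)).comp (toLocalInteger v))) =
        Spec.map (CommRingCat.ofHom (toClosureValuationSubring v))),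
      (∀ x, ((h x : closureValuationSubring (v.adicCompletion K)) : AlgebraicClosure (v.adicCompletion K)) =
        ((x : L) : AlgebraicClosure (v.adicCompletion K))) ∧
      Function.Injective h ∧
      h.comp ((algebraMap 𝒪[v.adicCompletion K] (integralClosure 𝒪[v.adicCompletion K] L)).comp (toLocalInteger v)) =
        toClosureValuationSubring v ∧
      Spec.map (CommRingCat.ofHom h) ≫ z₁.left = l₁.left ∧
      Spec.map (CommRingCat.ofHom h) ≫ z₂.left = l₂.left ∧
      (Over.homMk (Spec.map (CommRingCat.ofHom h)) w :
          specValuationSubring (closureValuationSubring (v.adicCompletion K)) (toClosureValuationSubring v) ⟶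
            Over.mk (Spec.map (CommRingCat.ofHom
            ((algebraMap 𝒪[v.adicCompletion K] (integralClosure 𝒪[v.adicCompletion K] L)).comp (toLocalInteger v))))) ≫ z₁ = l₁ ∧
      (Over.homMk (Spec.map (CommRingCat.ofHom h)) w :
          specValuationSubring (closureValuationSubring (v.adicCompletion K)) (toClosureValuationSubring v) ⟶
            Over.mk (Spec.map (CommRingCat.ofHom
            ((algebraMap 𝒪[v.adicCompletion K] (integralClosure 𝒪[v.adicCompletion K] L)).comp (toLocalInteger v))))) ≫ z₂ = l₂ := by
  have H₁ := exists_finiteStage_comp_eq_numberField v 𝒳₁ l₁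
  have H₂ := exists_finiteStage_comp_eq_numberField v 𝒳₂ l₂
  obtain ⟨L₁, hL₁, h₁, z₁, w₁, hh₁, -, hcomp₁, hz₁, -⟩ := H₁
  obtain ⟨L₂, hL₂, h₂, z₂, w₂, hh₂, -, hcomp₂, hz₂, -⟩ := H₂
  -- a common refinement `L ⊇ L₁, L₂` (opaque from here on)
  have hex : ∃ L, L₁ ≤ L ∧ L₂ ≤ L ∧ FiniteDimensional (v.adicCompletion K) L :=
    ⟨L₁ ⊔ L₂, le_sup_left, le_sup_right, IntermediateField.finiteDimensional_sup L₁ L₂⟩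
  obtain ⟨L, hle₁, hle₂, hL⟩ := hex
  haveI := hL
  -- (`have` then `obtain`: `rcases` on a non-variable term generalises it against the large goal, which is slow here)
  have hi₁' := exists_ringHom_integralClosure_of_le (F := v.adicCompletion K) hle₁
  have hi₂' := exists_ringHom_integralClosure_of_le (F := v.adicCompletion K) hle₂
  have hh' := exists_ringHom_integralClosure_closureValuationSubring (F := v.adicCompletion K) L
  obtain ⟨i₁, hi₁, -⟩ := hi₁'
  obtain ⟨i₂, hi₂, -⟩ := hi₂'
  obtain ⟨h, hh, hhinj⟩ := hh'
  have hhi₁ : h.comp i₁ = h₁ := comp_eq_of_coe_eq i₁ hi₁ h₁ hh₁ h hh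
  have hhi₂ : h.comp i₂ = h₂ := comp_eq_of_coe_eq i₂ hi₂ h₂ hh₂ h hh
  -- the structure maps `g_L = iⱼ ∘ g_{Lⱼ}`
  have hg : ∀ {L' : IntermediateField (v.adicCompletion K) (AlgebraicClosure (v.adicCompletion K))} (hL' : L' ≤ L)
      (i : integralClosure 𝒪[v.adicCompletion K] L' →+* integralClosure 𝒪[v.adicCompletion K] L)
      (_ : ∀ x, (((i x : integralClosure 𝒪[v.adicCompletion K] L) : L) : AlgebraicClosure (v.adicCompletion K)) =
        ((x : L') : AlgebraicClosure (v.adicCompletion K))),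
      i.comp ((algebraMap 𝒪[v.adicCompletion K] (integralClosure 𝒪[v.adicCompletion K] L')).comp (toLocalInteger v)) =
        (algebraMap 𝒪[v.adicCompletion K] (integralClosure 𝒪[v.adicCompletion K] L)).comp (toLocalInteger v) := by
    intro L' _ i hi
    apply RingHom.ext
    intro o
    apply hhinj
    apply Subtype.ext
    change ((h (i (algebraMap 𝒪[v.adicCompletion K] (integralClosure 𝒪[v.adicCompletion K] L') (toLocalInteger v o))) :
        closureValuationSubring (v.adicCompletion K)) : AlgebraicClosure (v.adicCompletion K)) =
      ((h (algebraMap 𝒪[v.adicCompletion K] (integralClosure 𝒪[v.adicCompletion K] L) (toLocalInteger v o)) :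
        closureValuationSubring (v.adicCompletion K)) : AlgebraicClosure (v.adicCompletion K))
    rw [hh, hh, hi, Subalgebra.coe_algebraMap, Subalgebra.coe_algebraMap,
      IsScalarTower.algebraMap_apply 𝒪[v.adicCompletion K] (v.adicCompletion K) L',
      IsScalarTower.algebraMap_apply 𝒪[v.adicCompletion K] (v.adicCompletion K) L]
    rfl
  have hg₁ := hg hle₁ i₁ hi₁
  have hg₂ := hg hle₂ i₂ hi₂
  -- (term-mode ∕ `congrArg`: `rw` with `RingHom.comp`-headed equations makes `kabstract` compare the pattern with the
  --  `comp`-shaped `algebraMap` instances hidden in the implicit `CommRingCat.of _` arguments — very slow here)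
  have hcomp : h.comp ((algebraMap 𝒪[v.adicCompletion K] (integralClosure 𝒪[v.adicCompletion K] L)).comp (toLocalInteger v)) =
      toClosureValuationSubring v :=
    ((congrArg h.comp hg₁.symm).trans ((RingHom.comp_assoc _ _ _).symm.trans
      (congrArg (fun r : integralClosure 𝒪[v.adicCompletion K] L₁ →+* closureValuationSubring (v.adicCompletion K) =>
        r.comp ((algebraMap 𝒪[v.adicCompletion K] (integralClosure 𝒪[v.adicCompletion K] L₁)).comp (toLocalInteger v)))
        hhi₁))).trans hcomp₁
  have mapc : ∀ {A B C : Type} [CommRing A] [CommRing B] [CommRing C] (f : A →+* B) (g : B →+* C),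
      Spec.map (CommRingCat.ofHom g) ≫ Spec.map (CommRingCat.ofHom f) = Spec.map (CommRingCat.ofHom (g.comp f)) := by
    intro A B C _ _ _ f g
    rw [← Spec.map_comp, ← CommRingCat.ofHom_comp]
  have w : Spec.map (CommRingCat.ofHom h) ≫
      Spec.map (CommRingCat.ofHom
        ((algebraMap 𝒪[v.adicCompletion K] (integralClosure 𝒪[v.adicCompletion K] L)).comp (toLocalInteger v))) =
      Spec.map (CommRingCat.ofHom (toClosureValuationSubring v)) :=
    (mapc _ _).trans (congrArg (fun r => Spec.map (CommRingCat.ofHom r)) hcomp)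
  -- refine the two stage points
  have wz₁ : Spec.map (CommRingCat.ofHom i₁) ≫ Spec.map (CommRingCat.ofHom
      ((algebraMap 𝒪[v.adicCompletion K] (integralClosure 𝒪[v.adicCompletion K] L₁)).comp (toLocalInteger v))) =
      Spec.map (CommRingCat.ofHom
        ((algebraMap 𝒪[v.adicCompletion K] (integralClosure 𝒪[v.adicCompletion K] L)).comp (toLocalInteger v))) :=
    (mapc _ _).trans (congrArg (fun r => Spec.map (CommRingCat.ofHom r)) hg₁)
  have wz₂ : Spec.map (CommRingCat.ofHom i₂) ≫ Spec.map (CommRingCat.ofHom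
      ((algebraMap 𝒪[v.adicCompletion K] (integralClosure 𝒪[v.adicCompletion K] L₂)).comp (toLocalInteger v))) =
      Spec.map (CommRingCat.ofHom
        ((algebraMap 𝒪[v.adicCompletion K] (integralClosure 𝒪[v.adicCompletion K] L)).comp (toLocalInteger v))) :=
    (mapc _ _).trans (congrArg (fun r => Spec.map (CommRingCat.ofHom r)) hg₂)
  have t₁ : Spec.map (CommRingCat.ofHom h) ≫ Spec.map (CommRingCat.ofHom i₁) = Spec.map (CommRingCat.ofHom h₁) :=
    (mapc _ _).trans (congrArg (fun r => Spec.map (CommRingCat.ofHom r)) hhi₁)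
  have t₂ : Spec.map (CommRingCat.ofHom h) ≫ Spec.map (CommRingCat.ofHom i₂) = Spec.map (CommRingCat.ofHom h₂) :=
    (mapc _ _).trans (congrArg (fun r => Spec.map (CommRingCat.ofHom r)) hhi₂)
  have e₁ : Spec.map (CommRingCat.ofHom h) ≫ (Spec.map (CommRingCat.ofHom i₁) ≫ z₁.left) = l₁.left :=
    ((Category.assoc _ _ _).symm.trans (congrArg (· ≫ z₁.left) t₁)).trans hz₁
  have e₂ : Spec.map (CommRingCat.ofHom h) ≫ (Spec.map (CommRingCat.ofHom i₂) ≫ z₂.left) = l₂.left :=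
    ((Category.assoc _ _ _).symm.trans (congrArg (· ≫ z₂.left) t₂)).trans hz₂
  let r₁ : Over.mk (Spec.map (CommRingCat.ofHom
        ((algebraMap 𝒪[v.adicCompletion K] (integralClosure 𝒪[v.adicCompletion K] L)).comp (toLocalInteger v)))) ⟶
      Over.mk (Spec.map (CommRingCat.ofHom
        ((algebraMap 𝒪[v.adicCompletion K] (integralClosure 𝒪[v.adicCompletion K] L₁)).comp (toLocalInteger v)))) :=
    Over.homMk (Spec.map (CommRingCat.ofHom i₁)) wz₁
  let r₂ : Over.mk (Spec.map (CommRingCat.ofHom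
        ((algebraMap 𝒪[v.adicCompletion K] (integralClosure 𝒪[v.adicCompletion K] L)).comp (toLocalInteger v)))) ⟶
      Over.mk (Spec.map (CommRingCat.ofHom
        ((algebraMap 𝒪[v.adicCompletion K] (integralClosure 𝒪[v.adicCompletion K] L₂)).comp (toLocalInteger v)))) :=
    Over.homMk (Spec.map (CommRingCat.ofHom i₂)) wz₂
  refine ⟨L, inferInstance, h, r₁ ≫ z₁, r₂ ≫ z₂, w, hh, hhinj, hcomp, e₁, e₂, ?_, ?_⟩
  · ext : 1; exact e₁
  · ext : 1; exact e₂

end Pair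

end Literature.AlgebraicGeometry.Motives

/-! ## §3 The fibre tuple at `x` ∕ at `red_𝓨 x` along a stage point `z` with `x̃ = Spec h ≫ z` -/

namespace Literature.AlgebraicGeometry.AbelianSchemes

namespace AbelianSchemeOver

open Literature.AlgebraicGeometry.Motives IsDedekindDomain IsDedekindDomain.HeightOneSpectrum
open scoped NumberField MonObj
open Literature.NumberTheory.EllipticCurves (genericFibre specGenericPoint)
open Literature.NumberTheory.GaloisRepresentations (closureValuationSubring)
open Literature.NumberTheory.DiophantineGeometry

variable {K : Type} [Field K] [NumberField K] {v : HeightOneSpectrum (𝓞 K)} {Y : SchemeOver K}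
  (𝓨 : IntegralModel (valuationSubringAtPrime K v) K Y) [IsProper 𝓨.total.hom]
  (x : AlgPoints Y (AlgebraicClosure (v.adicCompletion K)))
  {D : Type} [CommRing D] (g : valuationSubringAtPrime K v →+* D)
  (h : D →+* closureValuationSubring (v.adicCompletion K))
  (z : Over.mk (Spec.map (CommRingCat.ofHom g)) ⟶ 𝓨.total)

/-- **The fibre tuple at `x` is the fibre tuple of `𝒜_z` at the GEOMETRIC GENERIC point of the stage.**  For an abelian scheme
`𝒜 → 𝓨` over (the total space of) a proper model, `x ∈ Y(Ω)`, and ANY factorisation `x̃ = Spec h ≫ z` of its integral point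
`x̃ = extendPoint (modelPointsEquiv⁻¹ x)` through an `𝓞ᵥ`-algebra `D` (★ (ν1) `exists_finiteStage_comp_eq_numberField`: `D` a finite
Dedekind stage): ONE family of isomorphisms between the fibre at `x` of the generic family `𝒜|_Y` (along `ι_η = genericIso'⁻¹ ≫ pr₁`)
and the fibre of `𝒜_z := 𝒜 ×_𝓨 Spec D` at the `Ω`-point `Spec Ω → Spec R → Spec D`, natural in `𝒜` (homomorphisms `ι(a)`, `λ`) and
carrying pulled-back sections to pulled-back sections (★ `exists_iso_fibre_baseChange_of_comp_eq` along the ★ point equality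
`η_R ≫ x̃ = x ≫ ι_η`). [cite: SerreTate1968, §1] [cite: MumfordFogartyKirwan1994, Ch. 7 §2 Definition 7.2 (p. 129)] [cite: EGAIV3, Thm. 8.8.2] -/
theorem exists_iso_fibre_generic_along_stagePoint
    (hz : Spec.map (CommRingCat.ofHom h) ≫ z.left =
      (extendPoint (closureValuationSubring (v.adicCompletion K)) (toClosureValuationSubring v) 𝓨.total
        (𝓨.modelPointsEquiv.symm x)).left) :
    ∃ e : ∀ 𝒜 : AbelianSchemeOver 𝓨.total.left,
        ((𝒜.baseChange (𝓨.genericIso'.inv.left ≫ pullback.fst 𝓨.total.hom (specGenericPoint (valuationSubringAtPrime K v) K))).fibre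
            x.left).toAbelianVariety ≅
          ((𝒜.baseChange z.left).fibre
            (specGenericPoint (closureValuationSubring (v.adicCompletion K)) (AlgebraicClosure (v.adicCompletion K)) ≫
              Spec.map (CommRingCat.ofHom h))).toAbelianVariety,
      (∀ (𝒜 : AbelianSchemeOver 𝓨.total.left) (τ : 𝒜.Sections),
          AlgPoints.map (e 𝒜).hom.hom.hom.hom
              ((𝒜.baseChange _).restrictPt x.left (𝒜.sectionBaseChange _ τ)) =
            (𝒜.baseChange _).restrictPt _ (𝒜.sectionBaseChange _ τ)) ∧
      ∀ (𝒜 ℬ : AbelianSchemeOver 𝓨.total.left) (f : 𝒜.X ⟶ ℬ.X) [IsMonHom f],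
        (haveI := isMonHom_baseChangeHom f
           (𝓨.genericIso'.inv.left ≫ pullback.fst 𝓨.total.hom (specGenericPoint (valuationSubringAtPrime K v) K))
         haveI := isMonHom_baseChangeHom f z.left
         fibreHom (baseChangeHom f _) x.left ≫ (e ℬ).hom = (e 𝒜).hom ≫ fibreHom (baseChangeHom f _) _) :=
  exists_iso_fibre_baseChange_of_comp_eq _ _ (by
    rw [Category.assoc, hz]
    exact (𝓨.left_specFractionFieldι_comp_extendPoint_modelPointsEquiv_symm x).symm)

/-- **The fibre tuple at `red_𝓨 x` is the fibre tuple of `𝒜_z` at the GEOMETRIC CLOSED point of the stage under `R`.**  Same data;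
ONE family of isomorphisms between the fibre at the reduction `red_𝓨 x ∈ 𝓨_s(κ̄(v))` of the special family `𝒜|_{𝓨_s}` (along
`ι_s = pr₁`) and the fibre of `𝒜_z` at `Spec κ̄(v) ≅ Spec κ(R) → Spec R → Spec D` (`c ≫ s_R ≫ Spec h`), natural in `𝒜` and carrying
pulled-back sections to pulled-back sections — «reduction of points = reduction of tuples», read over the stage (★
`exists_iso_fibre_baseChange_of_comp_eq` along ★ `left_geomReductionMap_comp_fst` and `x̃ = Spec h ≫ z`).  With `D` Dedekind the
κ̄-point is a field point of `Spec D` at which ★ `isIsogeny_fibreHom_of_isIsogeny_genericFibre` evaluates.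
[cite: SerreTate1968, §1] [cite: MumfordFogartyKirwan1994, Ch. 7 §2 Definition 7.2 (p. 129)] [cite: EGAIV3, Thm. 8.8.2] -/
theorem exists_iso_fibre_special_along_stagePoint
    (hz : Spec.map (CommRingCat.ofHom h) ≫ z.left =
      (extendPoint (closureValuationSubring (v.adicCompletion K)) (toClosureValuationSubring v) 𝓨.total
        (𝓨.modelPointsEquiv.symm x)).left) :
    ∃ e : ∀ 𝒜 : AbelianSchemeOver 𝓨.total.left,
        ((𝒜.baseChange (pullback.fst 𝓨.total.hom (specResidueField v))).fibre (𝓨.geomReductionMap x).left).toAbelianVariety ≅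
          ((𝒜.baseChange z.left).fibre
            (((geomClosedPointIsoSpecResidueField v).inv.left ≫
              (specRingHomι (closureValuationSubring (v.adicCompletion K)) (toClosureValuationSubring v)
                (IsLocalRing.residue (closureValuationSubring (v.adicCompletion K)))).left) ≫
              Spec.map (CommRingCat.ofHom h))).toAbelianVariety,
      (∀ (𝒜 : AbelianSchemeOver 𝓨.total.left) (τ : 𝒜.Sections),
          AlgPoints.map (e 𝒜).hom.hom.hom.hom
              ((𝒜.baseChange _).restrictPt (𝓨.geomReductionMap x).left (𝒜.sectionBaseChange _ τ)) =
            (𝒜.baseChange _).restrictPt _ (𝒜.sectionBaseChange _ τ)) ∧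
      ∀ (𝒜 ℬ : AbelianSchemeOver 𝓨.total.left) (f : 𝒜.X ⟶ ℬ.X) [IsMonHom f],
        (haveI := isMonHom_baseChangeHom f (pullback.fst 𝓨.total.hom (specResidueField v))
         haveI := isMonHom_baseChangeHom f z.left
         fibreHom (baseChangeHom f _) (𝓨.geomReductionMap x).left ≫ (e ℬ).hom = (e 𝒜).hom ≫ fibreHom (baseChangeHom f _) _) :=
  exists_iso_fibre_baseChange_of_comp_eq _ _ (by
    rw [𝓨.left_geomReductionMap_comp_fst x, Category.assoc, Category.assoc, hz])

end AbelianSchemeOver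

end Literature.AlgebraicGeometry.AbelianSchemes

end
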